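import Summits.QuantumFields.YangMills.Theorems.BalabanUVNodesN19ShapeFaceN14AtRecordTV
import Summits.QuantumFields.YangMills.Theorems.BalabanUVNodesN19TVTiltSharpLeaf

/-!
# BalabanUVNodes ∕ N19 → N14 — THE U3 FACE FOR N14 AT THE RECORD's KEYS, TV EDITION, AT THE SHARP RATE `2·e^{2l₀}ρ_K ∕ (1 + (e^{2l₀} − 1)ρ_K) ≤ 2·e^{2l₀}·ρ_K`

Cell `pub-ymgap` (HUMAN RULING D-0062 Track A; D-0149 width seats), node N19 = NE7 (→ N14's binder), WIDTH SEAT `pub-ymgap-dag-n19-w2` (g3; bus INTENT-2).  The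
v1.x∕successor piece of THIS SEAT's landed g0 TV edition `…N19ShapeFaceN14AtRecordTV` (p585100, the faces n14-w2's `…N14BinderAtSpineReadingOfRecord13CoPH(V)` consume BY
NAME at `4·e^{2l₀}·ρ_K`) over this seat's g3 engine `…N19TVTiltSharp(Leaf)` (p600469 ∕ p601482): the SAME three faces with n19-c's constant `4B·e^{2l₀B}` replaced by the OPTIMAL
one.  A NEW file (nothing appended, nothing edited): the g0 statements stand; consumers switch by changing one name.  Filed `--kind proof --supports` K3⁷
`SpineGivenEndpointR13SepCoPH` = stmt-QuantumFields-20544 `--as helper`.  COUNT-NEUTRAL.  THEOREMS ONLY (0 `def`); imports the g0 TV file and 1b ONLY; every cited lemma BY NAME.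

WHAT IS PROVED ([folklore] ∘ 1b `tiltedMeanMatching_of_tv_sharp ∕ _half` + n14-c `tiltedMean_map`, binder prefixes of the g0 file VERBATIM).
* §1 two keys: `tiltedMeanMatching_of_tv_map₂_sharp` (`K ↦ 2B·κρ_K∕(1+(κ−1)ρ_K)`, `κ = e^{2l₀B}`) · `tiltedMeanMatching_of_tv_map₂_half` (`K ↦ 2B·κ·ρ_K`).
* §2 key levels of one scheme (`|prodW| ≤ 1`, so `B = 1`, `κ = e^{2l₀}`): `tiltedMeanMatching_of_tv_atKeys_sharp` · `tiltedMeanMatching_of_tv_atKeys_half` (`K ↦ 2·e^{2l₀}·ρ_K` — the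
  drop-in for `tiltedMeanMatching_of_tv_atKeys` in n14-w2's §3∕§4: the `l₀·η_K` share of the NE7 radius `vol·δ_K ≥ w_K + l₀·η_K` HALVES).
* §3 at the record's keys (MODULE B's class measures of slots, module 26 v1.1's prefix): `tiltedMeanMatching_classMeasureOfSlots_of_tv_sharp` · `…_of_tv_half` ·
  `core_and_tiltedMeanMatching_classWeightOfDatum₉_of_mass_of_tv_half` (the joint MASS_cl ∧ TV_cl face with N14's binder at `2·e^{2l₀}·ρ_K`; the `Core` half is module 26's,
  unchanged).

HONEST FRAMING.  ZERO ESTIMATE CONTENT: `hTV` ∕ `hM` are HYPOTHESIS SHAPES produced by nobody; by-name compositions; nothing of Bałaban's instantiated; NE7 ∕ NE1′ NOT PRINTED as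
two-run statements for d = 4 and NOT proved; N14 ∕ N19 NOT discharged; K3⁷ OPEN, not claimed; counts UNMOVED (typed 28∕28 · discharged 5∕27 · A 5∕28); no count claim.  One finite
four-torus programme at fixed `ε`; R4 closes the conditional finite-𝕋⁴ rung `BalabanLadder.UV` only — NOT ℝ⁴, NOT OS, NOT the Yang–Mills mass gap, NOT Clay.  0 `def`; 0 `sorry`;
standard axioms.
-/

set_option autoImplicit false

noncomputable section

open MeasureTheory ProbabilityTheory
open scoped ENNReal Matrix.Norms.L2Operator

namespace Summit.QuantumFields.YangMills.BalabanUVNodes.N19ShapeFaceN14AtRecordTVSharp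

open Summit.QuantumFields.BalabanUV.T4Continuum.NE1p.DressedMGFForm (tiltedMean MGFForm TiltedMeanMatching)
open Summit.QuantumFields.BalabanUV.T4Continuum.Spine.NE7 (Core)
open Summit.QuantumFields.YangMills.BalabanUVNodes.N19ClassSandwichRoad
open Summit.QuantumFields.YangMills.BalabanUVNodes.N19ClassSandwichAtRecord
open Summit.QuantumFields.YangMills.BalabanUVNodes.N19TVTiltSharp
open Summit.QuantumFields.YangMills.BalabanUVNodes.N19TVTiltSharpLeaf
open YMDAG.N14.ConvexFibreCauchy (tiltedMean_map)
open Literature.MathematicalPhysics.QuantumFieldTheory.Balaban1983to89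

/-! ## §1 GENERIC, TWO KEYS, sharp rate -/

section TwoKeysTV

variable {X : Type*} [MeasurableSpace X] {ΩA ΩB : ℕ → Type*} [∀ K, MeasurableSpace (ΩA K)] [∀ K, MeasurableSpace (ΩB K)]
  {ι : Type*} [DecidableEq ι] {l₀ B : ℝ} {T : ℕ → Finset ι} {Bad : ℕ → ℝ → Finset ι} {φ : X → ℝ}
  {a : ∀ K, ΩA K → X} {b : ∀ K, ΩB K → X}
  {νA : ∀ K, ι → Measure (ΩA K)} {νB : ∀ K, ι → Measure (ΩB K)} {ρ : ℕ → ℝ}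

/-- **THE U3 FACE FOR N14 IN THE TV CURRENCY, TWO KEYS, SHARP RATE**: the g0 `tiltedMeanMatching_of_tv_map₂` with `4B·e^{2l₀B}·ρ_K` replaced by
`2B·e^{2l₀B}ρ_K ∕ (1 + (e^{2l₀B} − 1)ρ_K)` (1b `tiltedMeanMatching_of_tv_sharp` on `X` + n14-c `tiltedMean_map`). [folklore] -/
theorem tiltedMeanMatching_of_tv_map₂_sharp (ha : ∀ K, Measurable (a K)) (hb : ∀ K, Measurable (b K)) (hφ : Measurable φ) (hφb : ∀ u, |φ u| ≤ B)
    (hB : 0 ≤ B) (hfinA : ∀ K, ∀ τ ∈ T K, IsFiniteMeasure (νA K τ)) (hfinB : ∀ K, ∀ τ ∈ T K, IsFiniteMeasure (νB K τ))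
    (hTV : ∀ (K : ℕ) (t : ℝ), |t| ≤ l₀ → ∀ τ ∈ T K \ Bad K t, ∀ S : Set X, MeasurableSet S →
      |((νB K τ).map (b K)).real S / ((νB K τ).map (b K)).real Set.univ - ((νA K τ).map (a K)).real S / ((νA K τ).map (a K)).real Set.univ| ≤ ρ K) :
    TiltedMeanMatching l₀ T Bad (fun K => φ ∘ a K) νA (fun K => φ ∘ b K) νB fun K =>
      2 * B * (Real.exp (2 * (l₀ * B)) * ρ K / (1 + (Real.exp (2 * (l₀ * B)) - 1) * ρ K)) := by
  have h := tiltedMeanMatching_of_tv_sharp (Ω := fun _ => X) (T := T) (Bad := Bad) (l₀ := l₀) (ρ := ρ)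
    (μA := fun K τ => (νA K τ).map (a K)) (μB := fun K τ => (νB K τ).map (b K)) (W := fun _ => φ)
    (fun K τ hτ => by haveI := hfinA K τ hτ; exact Measure.isFiniteMeasure_map (νA K τ) (a K))
    (fun K τ hτ => by haveI := hfinB K τ hτ; exact Measure.isFiniteMeasure_map (νB K τ) (b K)) hB (fun _ => hφ) (fun _ x => hφb x) hTV
  intro K t ht τ hτ s hs
  have hK := h K t ht τ hτ s hs
  rw [tiltedMean_map (hb K) hφ, tiltedMean_map (ha K) hφ] at hK
  exact hK

/-- **… AT THE LINEAR RATE `2B·e^{2l₀B}·ρ_K`** (HALF the g0 face's). [folklore] -/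
theorem tiltedMeanMatching_of_tv_map₂_half (ha : ∀ K, Measurable (a K)) (hb : ∀ K, Measurable (b K)) (hφ : Measurable φ) (hφb : ∀ u, |φ u| ≤ B)
    (hB : 0 ≤ B) (hfinA : ∀ K, ∀ τ ∈ T K, IsFiniteMeasure (νA K τ)) (hfinB : ∀ K, ∀ τ ∈ T K, IsFiniteMeasure (νB K τ))
    (hTV : ∀ (K : ℕ) (t : ℝ), |t| ≤ l₀ → ∀ τ ∈ T K \ Bad K t, ∀ S : Set X, MeasurableSet S →
      |((νB K τ).map (b K)).real S / ((νB K τ).map (b K)).real Set.univ - ((νA K τ).map (a K)).real S / ((νA K τ).map (a K)).real Set.univ| ≤ ρ K) :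
    TiltedMeanMatching l₀ T Bad (fun K => φ ∘ a K) νA (fun K => φ ∘ b K) νB fun K => 2 * B * Real.exp (2 * (l₀ * B)) * ρ K := by
  have h := tiltedMeanMatching_of_tv_half (Ω := fun _ => X) (T := T) (Bad := Bad) (l₀ := l₀) (ρ := ρ)
    (μA := fun K τ => (νA K τ).map (a K)) (μB := fun K τ => (νB K τ).map (b K)) (W := fun _ => φ)
    (fun K τ hτ => by haveI := hfinA K τ hτ; exact Measure.isFiniteMeasure_map (νA K τ) (a K))
    (fun K τ hτ => by haveI := hfinB K τ hτ; exact Measure.isFiniteMeasure_map (νB K τ) (b K)) hB (fun _ => hφ) (fun _ x => hφb x) hTV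
  intro K t ht τ hτ s hs
  have hK := h K t ht τ hτ s hs
  rw [tiltedMean_map (hb K) hφ, tiltedMean_map (ha K) hφ] at hK
  exact hK

end TwoKeysTV

/-! ## §2 At general key LEVELS of ONE scheme with a unit factorisation, sharp rate (`B = 1`) -/

section AtKeysTV

variable {G O : Type*} {S : Missing.TorusScheme G O} [MeasurableSpace G] {X : Type*} [MeasurableSpace X]
  {ι : Type*} [DecidableEq ι] {l₀ : ℝ} {T : ℕ → Finset ι} {Bad : ℕ → ℝ → Finset ι}
  {kA kB : ℕ → ℕ} {νA : ∀ K, ι → Measure (GaugeField (S.P (kA K)) 0 G)} {νB : ∀ K, ι → Measure (GaugeField (S.P (kB K)) 0 G)} {ρ : ℕ → ℝ}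

/-- **THE TV FACE AT GENERAL KEY LEVELS, SHARP RATE**: the g0 `tiltedMeanMatching_of_tv_atKeys` with `4·e^{2l₀}·ρ_K` replaced by
`2·e^{2l₀}ρ_K ∕ (1 + (e^{2l₀} − 1)ρ_K)` (`prodObs S k os = prodW ∘ A k`, `|prodW| ≤ 1`). [folklore] -/
theorem tiltedMeanMatching_of_tv_atKeys_sharp (N : T4VarianceMatching.UnitFactorisation S X) (os : List O)
    (hfinA : ∀ K, ∀ τ ∈ T K, IsFiniteMeasure (νA K τ)) (hfinB : ∀ K, ∀ τ ∈ T K, IsFiniteMeasure (νB K τ))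
    (hTV : ∀ (K : ℕ) (t : ℝ), |t| ≤ l₀ → ∀ τ ∈ T K \ Bad K t, ∀ S : Set X, MeasurableSet S →
      |((νB K τ).map (N.A (kB K))).real S / ((νB K τ).map (N.A (kB K))).real Set.univ -
          ((νA K τ).map (N.A (kA K))).real S / ((νA K τ).map (N.A (kA K))).real Set.univ| ≤ ρ K) :
    TiltedMeanMatching l₀ T Bad (fun K => T4GenFunBounds.prodObs S (kA K) os) νA (fun K => T4GenFunBounds.prodObs S (kB K) os) νB
      fun K => 2 * (Real.exp (2 * l₀) * ρ K / (1 + (Real.exp (2 * l₀) - 1) * ρ K)) := by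
  have hA : (fun K => T4GenFunBounds.prodObs S (kA K) os) = fun K => (fun u => (os.map fun o => N.W o u).prod) ∘ N.A (kA K) :=
    funext fun K => prodObs_eq_prodW_comp_A N (kA K) os
  have hB : (fun K => T4GenFunBounds.prodObs S (kB K) os) = fun K => (fun u => (os.map fun o => N.W o u).prod) ∘ N.A (kB K) :=
    funext fun K => prodObs_eq_prodW_comp_A N (kB K) os
  rw [hA, hB]
  have h := tiltedMeanMatching_of_tv_map₂_sharp (ΩA := fun K => GaugeField (S.P (kA K)) 0 G) (ΩB := fun K => GaugeField (S.P (kB K)) 0 G)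
    (a := fun K => N.A (kA K)) (b := fun K => N.A (kB K)) (T := T) (Bad := Bad) (l₀ := l₀) (νA := νA) (νB := νB) (ρ := ρ)
    (fun K => N.measurable_A (kA K)) (fun K => N.measurable_A (kB K))
    (measurable_prodW N os) (abs_prodW_le_one N os) zero_le_one hfinA hfinB hTV
  intro K t ht τ hτ s hs
  have hK := h K t ht τ hτ s hs
  simp only [mul_one] at hK ⊢
  exact hK

/-- **… AT THE LINEAR RATE `2·e^{2l₀}·ρ_K`** — the drop-in for the g0 `tiltedMeanMatching_of_tv_atKeys` (`4·e^{2l₀}·ρ_K`) in n14-w2's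
`tiltedMeanMatching_crOfRecord₁₃At_of_tv` ∕ `coreEdge_reading₁₃_of_coreZero_of_tv`. [folklore] -/
theorem tiltedMeanMatching_of_tv_atKeys_half (N : T4VarianceMatching.UnitFactorisation S X) (os : List O)
    (hfinA : ∀ K, ∀ τ ∈ T K, IsFiniteMeasure (νA K τ)) (hfinB : ∀ K, ∀ τ ∈ T K, IsFiniteMeasure (νB K τ))
    (hTV : ∀ (K : ℕ) (t : ℝ), |t| ≤ l₀ → ∀ τ ∈ T K \ Bad K t, ∀ S : Set X, MeasurableSet S →
      |((νB K τ).map (N.A (kB K))).real S / ((νB K τ).map (N.A (kB K))).real Set.univ -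
          ((νA K τ).map (N.A (kA K))).real S / ((νA K τ).map (N.A (kA K))).real Set.univ| ≤ ρ K) :
    TiltedMeanMatching l₀ T Bad (fun K => T4GenFunBounds.prodObs S (kA K) os) νA (fun K => T4GenFunBounds.prodObs S (kB K) os) νB
      fun K => 2 * Real.exp (2 * l₀) * ρ K := by
  have hA : (fun K => T4GenFunBounds.prodObs S (kA K) os) = fun K => (fun u => (os.map fun o => N.W o u).prod) ∘ N.A (kA K) :=
    funext fun K => prodObs_eq_prodW_comp_A N (kA K) os
  have hB : (fun K => T4GenFunBounds.prodObs S (kB K) os) = fun K => (fun u => (os.map fun o => N.W o u).prod) ∘ N.A (kB K) :=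
    funext fun K => prodObs_eq_prodW_comp_A N (kB K) os
  rw [hA, hB]
  have h := tiltedMeanMatching_of_tv_map₂_half (ΩA := fun K => GaugeField (S.P (kA K)) 0 G) (ΩB := fun K => GaugeField (S.P (kB K)) 0 G)
    (a := fun K => N.A (kA K)) (b := fun K => N.A (kB K)) (T := T) (Bad := Bad) (l₀ := l₀) (νA := νA) (νB := νB) (ρ := ρ)
    (fun K => N.measurable_A (kA K)) (fun K => N.measurable_A (kB K))
    (measurable_prodW N os) (abs_prodW_le_one N os) zero_le_one hfinA hfinB hTV
  intro K t ht τ hτ s hs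
  have hK := h K t ht τ hτ s hs
  simp only [mul_one] at hK ⊢
  exact hK

end AtKeysTV

/-! ## §3 AT THE RECORD's KEYS: MODULE B's class measures of slots, sharp ∕ half rate -/

section AtRecordTV

open Literature.MathematicalPhysics.QuantumFieldTheory.Balaban1983to89.Node00
open T4Continuum B14.Eq218Concrete
open Summit.QuantumFields.YangMills.BalabanUVNodes.N19MGFKernelTower (classMeasureOfSlots)
open Summit.QuantumFields.YangMills.BalabanUVNodes.N19MGFFormAtRecord (mgfForm_classWeightOfDatum₉_of_ppSelId)

variable {F : T4Family} {N : ℕ} [NeZero N] {ι : Type*} [DecidableEq ι] {l₀ vol : ℝ} {Bad : ℕ → ℝ → Finset ι} {r₁ ρ δ : ℕ → ℝ}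

/-- **THE U3 FACE FOR N14 AT THE RECORD's KEYS, TV CURRENCY, SHARP RATE** — the g0 `tiltedMeanMatching_classMeasureOfSlots_of_tv` with `4·e^{2l₀}·ρ_K` replaced by
`2·e^{2l₀}ρ_K ∕ (1 + (e^{2l₀} − 1)ρ_K)`; binder prefix VERBATIM. [folklore] -/
theorem tiltedMeanMatching_classMeasureOfSlots_of_tv_sharp (ϑ : Stage9Params F N) (hsel : ϑ.ppSel = ppSelIdOfRecord F ϑ.ν ϑ.τ9.M)
    (hw0 : ∀ p g k s' U V', 0 ≤ wOfRecord₉ F N ϑ p g k s' U V') (hw1 : ∀ p g k s' U V', wOfRecord₉ F N ϑ p g k s' U V' ≤ 1)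
    (hwm : ∀ (p : B12.RunParams) (g : ℕ → ℝ) k s',
      Measurable fun z : GaugeField (F.P p.K) (k + 1) (SU N) × GaugeField (F.P p.K) k (SU N) => wOfRecord₉ F N ϑ p g k s' z.2 z.1)
    (hχm : ∀ (p : B12.RunParams) (g : ℕ → ℝ) k s, Measurable (chiSeqOfRecord F N ϑ.ν ϑ.τ9.M g p.K k s))
    (D : FiniteEpsData F (SU N)) (hD : D.AvgMeasurable) (g₀ : ℕ → ℝ) (os : List (ULoop F))
    (pA pB : ℕ → B12.RunParams) (gA gB : ℕ → ℕ → ℝ) (kA kB : ℕ → ℕ) (T : ℕ → Finset ι)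
    (eA : ∀ K, ι → SeqOfRecord F ϑ.ν ϑ.τ9.M (gA K) (pA K).K (kA K)) (eB : ∀ K, ι → SeqOfRecord F ϑ.ν ϑ.τ9.M (gB K) (pB K).K (kB K))
    (hTV : ∀ (K : ℕ) (t : ℝ), |t| ≤ l₀ → ∀ τ ∈ T K \ Bad K t, ∀ S : Set (GaugeField (F.P 0) 0 (SU N)), MeasurableSet S →
      |((classMeasureOfSlots F N ϑ.ν ϑ.τ9 (wOfRecord₉ F N ϑ) (pB K) (gB K) (Missing.boltzmann (F.P (pB K).K) ((g₀ (pB K).K)⁻¹ ^ 2))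
            (kB K) (eB K τ)).map ((T4RunLadder.unitFactorisation D hD g₀).A (pB K).K)).real S /
          ((classMeasureOfSlots F N ϑ.ν ϑ.τ9 (wOfRecord₉ F N ϑ) (pB K) (gB K) (Missing.boltzmann (F.P (pB K).K) ((g₀ (pB K).K)⁻¹ ^ 2))
            (kB K) (eB K τ)).map ((T4RunLadder.unitFactorisation D hD g₀).A (pB K).K)).real Set.univ -
        ((classMeasureOfSlots F N ϑ.ν ϑ.τ9 (wOfRecord₉ F N ϑ) (pA K) (gA K) (Missing.boltzmann (F.P (pA K).K) ((g₀ (pA K).K)⁻¹ ^ 2))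
            (kA K) (eA K τ)).map ((T4RunLadder.unitFactorisation D hD g₀).A (pA K).K)).real S /
          ((classMeasureOfSlots F N ϑ.ν ϑ.τ9 (wOfRecord₉ F N ϑ) (pA K) (gA K) (Missing.boltzmann (F.P (pA K).K) ((g₀ (pA K).K)⁻¹ ^ 2))
            (kA K) (eA K τ)).map ((T4RunLadder.unitFactorisation D hD g₀).A (pA K).K)).real Set.univ| ≤ ρ K) :
    TiltedMeanMatching l₀ T Bad (fun K => T4GenFunBounds.prodObs (D.scheme g₀) (pA K).K os)
      (fun K τ => classMeasureOfSlots F N ϑ.ν ϑ.τ9 (wOfRecord₉ F N ϑ) (pA K) (gA K) (Missing.boltzmann (F.P (pA K).K) ((g₀ (pA K).K)⁻¹ ^ 2))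
        (kA K) (eA K τ))
      (fun K => T4GenFunBounds.prodObs (D.scheme g₀) (pB K).K os)
      (fun K τ => classMeasureOfSlots F N ϑ.ν ϑ.τ9 (wOfRecord₉ F N ϑ) (pB K) (gB K) (Missing.boltzmann (F.P (pB K).K) ((g₀ (pB K).K)⁻¹ ^ 2))
        (kB K) (eB K τ))
      fun K => 2 * (Real.exp (2 * l₀) * ρ K / (1 + (Real.exp (2 * l₀) - 1) * ρ K)) :=
  tiltedMeanMatching_of_tv_atKeys_sharp (T4RunLadder.unitFactorisation D hD g₀) os
    (mgfForm_classWeightOfDatum₉_of_ppSelId ϑ hsel hw0 hw1 hwm hχm D hD g₀ os pA gA kA T eA).finite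
    (mgfForm_classWeightOfDatum₉_of_ppSelId ϑ hsel hw0 hw1 hwm hχm D hD g₀ os pB gB kB T eB).finite hTV

/-- **… AT THE LINEAR RATE `2·e^{2l₀}·ρ_K`** (HALF the g0 face's `4·e^{2l₀}·ρ_K`). [folklore] -/
theorem tiltedMeanMatching_classMeasureOfSlots_of_tv_half (ϑ : Stage9Params F N) (hsel : ϑ.ppSel = ppSelIdOfRecord F ϑ.ν ϑ.τ9.M)
    (hw0 : ∀ p g k s' U V', 0 ≤ wOfRecord₉ F N ϑ p g k s' U V') (hw1 : ∀ p g k s' U V', wOfRecord₉ F N ϑ p g k s' U V' ≤ 1)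
    (hwm : ∀ (p : B12.RunParams) (g : ℕ → ℝ) k s',
      Measurable fun z : GaugeField (F.P p.K) (k + 1) (SU N) × GaugeField (F.P p.K) k (SU N) => wOfRecord₉ F N ϑ p g k s' z.2 z.1)
    (hχm : ∀ (p : B12.RunParams) (g : ℕ → ℝ) k s, Measurable (chiSeqOfRecord F N ϑ.ν ϑ.τ9.M g p.K k s))
    (D : FiniteEpsData F (SU N)) (hD : D.AvgMeasurable) (g₀ : ℕ → ℝ) (os : List (ULoop F))
    (pA pB : ℕ → B12.RunParams) (gA gB : ℕ → ℕ → ℝ) (kA kB : ℕ → ℕ) (T : ℕ → Finset ι)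
    (eA : ∀ K, ι → SeqOfRecord F ϑ.ν ϑ.τ9.M (gA K) (pA K).K (kA K)) (eB : ∀ K, ι → SeqOfRecord F ϑ.ν ϑ.τ9.M (gB K) (pB K).K (kB K))
    (hTV : ∀ (K : ℕ) (t : ℝ), |t| ≤ l₀ → ∀ τ ∈ T K \ Bad K t, ∀ S : Set (GaugeField (F.P 0) 0 (SU N)), MeasurableSet S →
      |((classMeasureOfSlots F N ϑ.ν ϑ.τ9 (wOfRecord₉ F N ϑ) (pB K) (gB K) (Missing.boltzmann (F.P (pB K).K) ((g₀ (pB K).K)⁻¹ ^ 2))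
            (kB K) (eB K τ)).map ((T4RunLadder.unitFactorisation D hD g₀).A (pB K).K)).real S /
          ((classMeasureOfSlots F N ϑ.ν ϑ.τ9 (wOfRecord₉ F N ϑ) (pB K) (gB K) (Missing.boltzmann (F.P (pB K).K) ((g₀ (pB K).K)⁻¹ ^ 2))
            (kB K) (eB K τ)).map ((T4RunLadder.unitFactorisation D hD g₀).A (pB K).K)).real Set.univ -
        ((classMeasureOfSlots F N ϑ.ν ϑ.τ9 (wOfRecord₉ F N ϑ) (pA K) (gA K) (Missing.boltzmann (F.P (pA K).K) ((g₀ (pA K).K)⁻¹ ^ 2))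
            (kA K) (eA K τ)).map ((T4RunLadder.unitFactorisation D hD g₀).A (pA K).K)).real S /
          ((classMeasureOfSlots F N ϑ.ν ϑ.τ9 (wOfRecord₉ F N ϑ) (pA K) (gA K) (Missing.boltzmann (F.P (pA K).K) ((g₀ (pA K).K)⁻¹ ^ 2))
            (kA K) (eA K τ)).map ((T4RunLadder.unitFactorisation D hD g₀).A (pA K).K)).real Set.univ| ≤ ρ K) :
    TiltedMeanMatching l₀ T Bad (fun K => T4GenFunBounds.prodObs (D.scheme g₀) (pA K).K os)
      (fun K τ => classMeasureOfSlots F N ϑ.ν ϑ.τ9 (wOfRecord₉ F N ϑ) (pA K) (gA K) (Missing.boltzmann (F.P (pA K).K) ((g₀ (pA K).K)⁻¹ ^ 2))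
        (kA K) (eA K τ))
      (fun K => T4GenFunBounds.prodObs (D.scheme g₀) (pB K).K os)
      (fun K τ => classMeasureOfSlots F N ϑ.ν ϑ.τ9 (wOfRecord₉ F N ϑ) (pB K) (gB K) (Missing.boltzmann (F.P (pB K).K) ((g₀ (pB K).K)⁻¹ ^ 2))
        (kB K) (eB K τ))
      fun K => 2 * Real.exp (2 * l₀) * ρ K :=
  tiltedMeanMatching_of_tv_atKeys_half (T4RunLadder.unitFactorisation D hD g₀) os
    (mgfForm_classWeightOfDatum₉_of_ppSelId ϑ hsel hw0 hw1 hwm hχm D hD g₀ os pA gA kA T eA).finite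
    (mgfForm_classWeightOfDatum₉_of_ppSelId ϑ hsel hw0 hw1 hwm hχm D hD g₀ os pB gB kB T eB).finite hTV

/-- **THE JOINT FACE AT THE RECORD, N14's HALF AT THE HALF RATE**: MASS_cl(`r₁`) ∧ TV_cl(`ρ`) with `r₁ K + (e^{2l₀} − 1)·ρ K ≤ vol·δ K` ⇒ module 26 v1.1's dressed
`Spine.NE7.Core` for `classWeightOfDatum₉` (unchanged, BY NAME) AND N14's binder with `η K = 2·e^{2l₀}·ρ K` (was `4·e^{2l₀}·ρ K`). [folklore] -/
theorem core_and_tiltedMeanMatching_classWeightOfDatum₉_of_mass_of_tv_half (ϑ : Stage9Params F N) (hsel : ϑ.ppSel = ppSelIdOfRecord F ϑ.ν ϑ.τ9.M)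
    (hw0 : ∀ p g k s' U V', 0 ≤ wOfRecord₉ F N ϑ p g k s' U V') (hw1 : ∀ p g k s' U V', wOfRecord₉ F N ϑ p g k s' U V' ≤ 1)
    (hwm : ∀ (p : B12.RunParams) (g : ℕ → ℝ) k s',
      Measurable fun z : GaugeField (F.P p.K) (k + 1) (SU N) × GaugeField (F.P p.K) k (SU N) => wOfRecord₉ F N ϑ p g k s' z.2 z.1)
    (hχm : ∀ (p : B12.RunParams) (g : ℕ → ℝ) k s, Measurable (chiSeqOfRecord F N ϑ.ν ϑ.τ9.M g p.K k s))
    (D : FiniteEpsData F (SU N)) (hD : D.AvgMeasurable) (g₀ : ℕ → ℝ) (os : List (ULoop F))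
    (pA pB : ℕ → B12.RunParams) (gA gB : ℕ → ℕ → ℝ) (kA kB : ℕ → ℕ) (T : ℕ → Finset ι)
    (eA : ∀ K, ι → SeqOfRecord F ϑ.ν ϑ.τ9.M (gA K) (pA K).K (kA K)) (eB : ∀ K, ι → SeqOfRecord F ϑ.ν ϑ.τ9.M (gB K) (pB K).K (kB K))
    (hM : ∀ K : ℕ, ∃ c : ℝ, ∀ t : ℝ, |t| ≤ l₀ → ∀ τ ∈ T K \ Bad K t,
      ENNReal.ofReal (Real.exp (c - r₁ K)) *
          ((classMeasureOfSlots F N ϑ.ν ϑ.τ9 (wOfRecord₉ F N ϑ) (pA K) (gA K) (Missing.boltzmann (F.P (pA K).K) ((g₀ (pA K).K)⁻¹ ^ 2))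
            (kA K) (eA K τ)).map ((T4RunLadder.unitFactorisation D hD g₀).A (pA K).K)) Set.univ ≤
        ((classMeasureOfSlots F N ϑ.ν ϑ.τ9 (wOfRecord₉ F N ϑ) (pB K) (gB K) (Missing.boltzmann (F.P (pB K).K) ((g₀ (pB K).K)⁻¹ ^ 2))
            (kB K) (eB K τ)).map ((T4RunLadder.unitFactorisation D hD g₀).A (pB K).K)) Set.univ ∧
      ((classMeasureOfSlots F N ϑ.ν ϑ.τ9 (wOfRecord₉ F N ϑ) (pB K) (gB K) (Missing.boltzmann (F.P (pB K).K) ((g₀ (pB K).K)⁻¹ ^ 2))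
            (kB K) (eB K τ)).map ((T4RunLadder.unitFactorisation D hD g₀).A (pB K).K)) Set.univ ≤
        ENNReal.ofReal (Real.exp (c + r₁ K)) *
          ((classMeasureOfSlots F N ϑ.ν ϑ.τ9 (wOfRecord₉ F N ϑ) (pA K) (gA K) (Missing.boltzmann (F.P (pA K).K) ((g₀ (pA K).K)⁻¹ ^ 2))
            (kA K) (eA K τ)).map ((T4RunLadder.unitFactorisation D hD g₀).A (pA K).K)) Set.univ)
    (hTV : ∀ (K : ℕ) (t : ℝ), |t| ≤ l₀ → ∀ τ ∈ T K \ Bad K t, ∀ S : Set (GaugeField (F.P 0) 0 (SU N)), MeasurableSet S →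
      |((classMeasureOfSlots F N ϑ.ν ϑ.τ9 (wOfRecord₉ F N ϑ) (pB K) (gB K) (Missing.boltzmann (F.P (pB K).K) ((g₀ (pB K).K)⁻¹ ^ 2))
            (kB K) (eB K τ)).map ((T4RunLadder.unitFactorisation D hD g₀).A (pB K).K)).real S /
          ((classMeasureOfSlots F N ϑ.ν ϑ.τ9 (wOfRecord₉ F N ϑ) (pB K) (gB K) (Missing.boltzmann (F.P (pB K).K) ((g₀ (pB K).K)⁻¹ ^ 2))
            (kB K) (eB K τ)).map ((T4RunLadder.unitFactorisation D hD g₀).A (pB K).K)).real Set.univ -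
        ((classMeasureOfSlots F N ϑ.ν ϑ.τ9 (wOfRecord₉ F N ϑ) (pA K) (gA K) (Missing.boltzmann (F.P (pA K).K) ((g₀ (pA K).K)⁻¹ ^ 2))
            (kA K) (eA K τ)).map ((T4RunLadder.unitFactorisation D hD g₀).A (pA K).K)).real S /
          ((classMeasureOfSlots F N ϑ.ν ϑ.τ9 (wOfRecord₉ F N ϑ) (pA K) (gA K) (Missing.boltzmann (F.P (pA K).K) ((g₀ (pA K).K)⁻¹ ^ 2))
            (kA K) (eA K τ)).map ((T4RunLadder.unitFactorisation D hD g₀).A (pA K).K)).real Set.univ| ≤ ρ K)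
    (hw : ∀ K, r₁ K + (Real.exp (2 * (l₀ * 1)) - 1) * ρ K ≤ vol * δ K) :
    Core l₀ vol T Bad (fun K t τ => classWeightOfDatum₉ F N ϑ D g₀ os (pA K) (gA K) (kA K) t (eA K τ))
        (fun K t τ => classWeightOfDatum₉ F N ϑ D g₀ os (pB K) (gB K) (kB K) t (eB K τ)) δ ∧
      TiltedMeanMatching l₀ T Bad (fun K => T4GenFunBounds.prodObs (D.scheme g₀) (pA K).K os)
        (fun K τ => classMeasureOfSlots F N ϑ.ν ϑ.τ9 (wOfRecord₉ F N ϑ) (pA K) (gA K) (Missing.boltzmann (F.P (pA K).K) ((g₀ (pA K).K)⁻¹ ^ 2))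
          (kA K) (eA K τ))
        (fun K => T4GenFunBounds.prodObs (D.scheme g₀) (pB K).K os)
        (fun K τ => classMeasureOfSlots F N ϑ.ν ϑ.τ9 (wOfRecord₉ F N ϑ) (pB K) (gB K) (Missing.boltzmann (F.P (pB K).K) ((g₀ (pB K).K)⁻¹ ^ 2))
          (kB K) (eB K τ))
        fun K => 2 * Real.exp (2 * l₀) * ρ K :=
  ⟨core_classWeightOfDatum₉_of_mass_of_tv ϑ hsel hw0 hw1 hwm hχm D hD g₀ os pA pB gA gB kA kB T eA eB hM hTV hw,
    tiltedMeanMatching_classMeasureOfSlots_of_tv_half ϑ hsel hw0 hw1 hwm hχm D hD g₀ os pA pB gA gB kA kB T eA eB hTV⟩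

end AtRecordTV

end Summit.QuantumFields.YangMills.BalabanUVNodes.N19ShapeFaceN14AtRecordTVSharp

end
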